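import Summits.NavierStokesRegularity.NavierStokesRegularity.Theorems.ScenarioCensusRowF1OneLevelTop
import HarnessLib

/-!
# LINE 35 «one-level-top» port, part 2/3: §4 the LERAY-NORMALISED MOVING-CENTRE ZOOM (`lerayLevel`, the zoom package at a definite level)

Re-homed for the scenario census (typer seat ns-census-typer-1 g9; the cells F1lv / F1td and the floor OLF are MEMBERS OF RECORD «DECIDED IN KERNEL IN FILES» of row F1 since
census v1.101 (item 73: critic PASS; ref ns-census-ref g13 PRE-CHECK ✓ §18.9; lead-presearch label); this port makes them TREE-decided): VERBATIM PORT of ns-idea-3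
LINE 35 «one-level-top», `pub/ideators/ns-idea-3/lines/one-level-top/line-one-level-top.lean` sha16 06846e90c67bb04b (874 l., lean check rc 0, 0 sorry), split for the
400-line rule into `ScenarioCensusRowF1OneLevelTop` (§1–§3) → `…OneLevelTopZoom` (§4) → `…OneLevelTopRows` (§5–§7 + census KEYS).  Lean text VERBATIM in namespace
`…Theorems.ScenarioCensus.OneLevelTop` (the line's `…Cruxes.ScenarioCensusRowF1.OneLevelTopLine` re-homed); port edits: LINE 34's VERBATIM restatements (`lagTime`, `topSet`,
`HasDisjointTops`, `Row_F1dj`, the signal lemmas, `rowF1dj_holds`) and LINE 15's `tendsto_physicalTime` are taken BY NAME from the landed two-time-top / columnar-top ports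
(`TwoTimeTop.…`, `ColumnarTop.…`); `@[conjecture]` on the residual `LevelCollapse` (≡ `ScenarioCensus.Row_F1`, OPEN); six one-line docstrings added (gate lint).
Statements untouched.

No census VALUE is moved here (row F1 stays OPEN-WITH-LINE; the members become TREE-decided by name); NS regularity is NOT proved; `Row_F1` is untouched (zero
movement, `levelCollapse_iff_rowF1`); no summit statement is proved by this file. Lemmas that restate already-landed tree declarations are taken BY NAME (gate lint `dedup.landed`): `rowF1dj_holds` = `TwoTimeTop.rowF1dj_holds`, `tendsto_physicalTime` = `ColumnarTop.tendsto_physicalTime`.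
-/

-- the summit and its single problem share the name `NavierStokesRegularity` (D-0017 nested layout)
set_option linter.dupNamespace false

noncomputable section

open MeasureTheory Set Function Filter TopologicalSpace Metric
open scoped Topology NNReal ENNReal

namespace Summit.NavierStokesRegularity.NavierStokesRegularity.Theorems.ScenarioCensus.OneLevelTop

open Literature.Analysis Literature.Analysis.FluidPDE
open Summit.NavierStokesRegularity.NavierStokesRegularity.Theorems
open Summit.NavierStokesRegularity.NavierStokesRegularity.Theses

/-! ## §4 MECHANISM, part 3 — the LERAY-NORMALISED MOVING-CENTRE ZOOM

Every earlier line of this seat zooms at the SINGULAR POINT `x₀` (backward-singular cylinders, `ε`-regularity, nontriviality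
of the limit by unboundedness).  Here the zoom is centred at NEAR-MAXIMUM points `(t_k, x_k)` of the dimensionless speed, which
exist at times `t_k ↑ T` by LERAY'S RATE in the Clay frame (tree `typeICertificateLadder_rungZero`, BY NAME: a classical Clay
solution with `√(T − t)|u| ≤ c_L√ν` eventually extends), with the scale LOCKED to the remaining life-span, `c_k² ν = T − t_k`.
The limit is then NORMALISED at a definite space-time point, `‖W(−1, 0)‖ ≥ c_L`, with the UNIVERSAL constant `c_L` — which is
what lets a level be chosen before the solution. -/

/-- **Leray's universal level `c_L`** (tree `typeICertificateLadder_rungZero`, Leray 1934 §19 (3.9), Clay frame). -/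
def lerayLevel : ℝ := Classical.choose typeICertificateLadder_rungZero

/-- The Leray level is positive. -/
theorem lerayLevel_pos : 0 < lerayLevel := (Classical.choose_spec typeICertificateLadder_rungZero).1

/-- The defining property of the Leray level. -/
theorem lerayLevel_spec {ν T : ℝ} (hν : 0 < ν) (hT : 0 < T) {u : ℝ → E3 → E3} {p : ℝ → E3 → ℝ}
    (hsol : IsClassicalNSSolutionOn (Ico 0 T) ν 0 u p) (hLH : IsLerayHopfOn T ν 0 (u 0) u)
    (hdec : HasRapidSpatialDecay (u 0))
    (hev : ∀ᶠ t in 𝓝[<] T, ∀ x : E3, Real.sqrt (T - t) * ‖u t x‖ ≤ lerayLevel * Real.sqrt ν) :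
    HasSmoothExtensionPast ν 0 u T :=
  (Classical.choose_spec typeICertificateLadder_rungZero).2 ν T hν hT u p hsol hLH hdec hev

/-- **Near-maximum points of a non-extending solution** (Leray's floor, frequently-form): at times arbitrarily close to `T`
some point is `c_L`-fast. -/
theorem frequently_fast {ν T : ℝ} (hν : 0 < ν) (hT : 0 < T) {u : ℝ → E3 → E3} {p : ℝ → E3 → ℝ}
    (hsol : IsClassicalNSSolutionOn (Ico 0 T) ν 0 u p) (hLH : IsLerayHopfOn T ν 0 (u 0) u)
    (hdec : HasRapidSpatialDecay (u 0)) (hmax : ¬ HasSmoothExtensionPast ν 0 u T) :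
    ∃ᶠ t in 𝓝[<] T, ∃ x : E3, lerayLevel * Real.sqrt ν < Real.sqrt (T - t) * ‖u t x‖ := by
  by_contra hno
  rw [Filter.not_frequently] at hno
  apply hmax (lerayLevel_spec hν hT hsol hLH hdec ?_)
  filter_upwards [hno] with t ht x
  by_contra hlt
  exact ht ⟨x, not_le.1 hlt⟩

/-- The rate window of a dimensionless Type-I constant. -/
theorem exists_window_of_hasTypeIConstant {ν T M : ℝ} (hT : 0 < T) {u : ℝ → E3 → E3}
    (h : HasTypeIConstant ν T M u) :
    ∃ δ : ℝ, 0 < δ ∧ δ ≤ T ∧ ∀ t ∈ Ioo (T - δ) T, ∀ x : E3, Real.sqrt (T - t) * ‖u t x‖ ≤ M * Real.sqrt ν := by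
  obtain ⟨T₁, hT₁T, hT₁⟩ := mem_nhdsLT_iff_exists_Ioo_subset.1 h
  refine ⟨min (T - T₁) T, lt_min (sub_pos.2 hT₁T) hT, min_le_right _ _, fun t ht x => ?_⟩
  have hδT₁ : min (T - T₁) T ≤ T - T₁ := min_le_left _ _
  exact hT₁ ⟨by linarith [ht.1], ht.2⟩ x

-- `tendsto_physicalTime`: the line restates the tree's `ColumnarTop.tendsto_physicalTime`; taken BY NAME (gate lint dedup.landed).

/-- **THE LERAY-NORMALISED MOVING-CENTRE ZOOM PACKAGE.**  Let `u` be a classical Clay solution on `[0, T)` with dimensionless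
Type-I constant `M` which does NOT extend past `T`.  Then there are scales `c_j ↓ 0`, centres `x_j` and a member `W ∈ 𝒦_M` of the
limit class — with the SAME constant `M` — such that the zooms `c_j u(T + c_j² ν t, x_j + c_j ν y)` converge to `W(t, y)` at every
point of the open past, and `W` is NORMALISED: `‖W(−1, 0)‖ ≥ c_L` (Leray's universal level). -/
theorem exists_normalisedZoom_package {ν T M : ℝ} (hν : 0 < ν) (hT : 0 < T)
    {u : ℝ → E3 → E3} {p : ℝ → E3 → ℝ}
    (hsol : IsClassicalNSSolutionOn (Ico 0 T) ν 0 u p) (hLH : IsLerayHopfOn T ν 0 (u 0) u)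
    (hdec : HasRapidSpatialDecay (u 0)) (hM : HasTypeIConstant ν T M u)
    (hmax : ¬ HasSmoothExtensionPast ν 0 u T) :
    ∃ (c : ℕ → ℝ) (x : ℕ → E3) (W : ℝ → E3 → E3),
      (∀ j, 0 < c j) ∧ Tendsto c atTop (𝓝 0) ∧ IsTypeIAncientMild M W ∧
      (∀ t < 0, ∀ y : E3,
        Tendsto (fun j => (c j * 1) • u (T + c j ^ 2 * ν * t) (x j + (c j * ν) • y)) atTop (𝓝 (W t y))) ∧
      lerayLevel ≤ ‖W (-1) 0‖ := by
  -- ## (1) the rate window and the near-maximum sequence `(t_k, x_k)`, `T − t_k < δ/(k+2)`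
  obtain ⟨δ, hδ, hδT, hrate⟩ := exists_window_of_hasTypeIConstant hT hM
  have hfreq := frequently_fast hν hT hsol hLH hdec hmax
  have hseq : ∀ k : ℕ, ∃ t : ℝ, ∃ x : E3, t ∈ Ioo (T - δ / ((k : ℝ) + 2)) T ∧
      lerayLevel * Real.sqrt ν < Real.sqrt (T - t) * ‖u t x‖ := by
    intro k
    have hpos : 0 < δ / ((k : ℝ) + 2) := by positivity
    have hIoo : ∀ᶠ t in 𝓝[<] T, t ∈ Ioo (T - δ / ((k : ℝ) + 2)) T := Ioo_mem_nhdsLT (by linarith)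
    obtain ⟨t, ⟨x, hx⟩, ht⟩ := (hfreq.and_eventually hIoo).exists
    exact ⟨t, x, ht, hx⟩
  choose t x htI hfast using hseq
  have hTt : ∀ k, 0 < T - t k := fun k => sub_pos.2 (htI k).2
  have hTtδ : ∀ k, T - t k < δ / ((k : ℝ) + 2) := fun k => by linarith [(htI k).1]
  -- ## (2) scales `c_k = √((T − t_k)/ν)`: `c_k² ν = T − t_k`, `c_k → 0`
  set c : ℕ → ℝ := fun k => Real.sqrt ((T - t k) / ν) with hc
  have hcpos : ∀ k, 0 < c k := fun k => Real.sqrt_pos.2 (div_pos (hTt k) hν)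
  have hc2 : ∀ k, c k ^ 2 * ν = T - t k := by
    intro k
    simp only [hc]
    rw [Real.sq_sqrt (div_pos (hTt k) hν).le]
    field_simp
  have hclim : Tendsto c atTop (𝓝 0) := by
    have hk2 : Tendsto (fun k : ℕ => (k : ℝ) + 2) atTop atTop :=
      tendsto_atTop_add_const_right _ _ tendsto_natCast_atTop_atTop
    have hup0 : Tendsto (fun k : ℕ => δ / ((k : ℝ) + 2)) atTop (𝓝 0) := tendsto_const_nhds.div_atTop hk2
    have hupper : Tendsto (fun k : ℕ => δ / ((k : ℝ) + 2) / ν) atTop (𝓝 0) := by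
      simpa using hup0.div_const ν
    have h1 : Tendsto (fun k => (T - t k) / ν) atTop (𝓝 0) :=
      tendsto_of_tendsto_of_tendsto_of_le_of_le tendsto_const_nhds hupper
        (fun k => (div_pos (hTt k) hν).le) (fun k => div_le_div_of_nonneg_right (hTtδ k).le hν.le)
    have h2 := h1.sqrt
    rw [Real.sqrt_zero] at h2
    exact h2
  -- ## (3) the moving-centre zooms `w_k(s, y) = c_k u(T + c_k² ν s, x_k + c_k ν y)` and their windows `(A_k, 0)`, `A_k → −∞`
  have hα : (1 : ℝ) = ν / ν := (div_self hν.ne').symm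
  have hβ : ν = ν ^ 2 / ν := by rw [sq, mul_div_cancel_right₀ _ hν.ne']
  set w : ℕ → ℝ → E3 → E3 := fun k => (c k * 1) • stPull (c k ^ 2 * ν) (c k * ν) T (x k) u with hw
  set Aw : ℕ → ℝ := fun k => -(δ / (c k ^ 2 * ν)) with hA
  have hAwle : ∀ k, Aw k ≤ -((k : ℝ) + 2) := by
    intro k
    have hk : 0 < (k : ℝ) + 2 := by positivity
    have hprod : (T - t k) * ((k : ℝ) + 2) < δ := (lt_div_iff₀ hk).1 (hTtδ k)
    simp only [hA]
    rw [hc2 k, neg_le_neg_iff, le_div_iff₀ (hTt k)]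
    linarith [mul_comm (T - t k) ((k : ℝ) + 2)]
  have hAlim : Tendsto Aw atTop atBot := by
    have h1 : Tendsto (fun k : ℕ => -((k : ℝ) + 2)) atTop atBot :=
      tendsto_neg_atTop_atBot.comp (tendsto_atTop_add_const_right _ _ tendsto_natCast_atTop_atTop)
    exact tendsto_atBot_mono hAwle h1
  -- per-scale facts (any centre, any positive scale)
  have hcW : ∀ k, ContinuousOn (uncurry (w k)) (Ioo (Aw k) 0 ×ˢ univ) := fun k =>
    zoom_continuousOn hν hsol hν hα hβ (hcpos k) hδT
  have hdivW : ∀ k, ∀ s ∈ Ioo (Aw k) 0, IsWeaklyDivFree (w k s) := fun k s hs =>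
    zoom_isWeaklyDivFree hν hsol hν hα hβ (hcpos k) hδT hs
  have hmildW : ∀ k, ∀ s s' : ℝ, Aw k < s → s < s' → s' < 0 → ∀ y,
      w k s' y = UnboundedOperators.heatExtension (w k s) (s' - s) y -
        oseenDuhamel 1 s (w k) (w k) s' y := fun k s s' hs hss' hs' y =>
    zoom_oseen hν hT hsol hLH hdec hν hα hβ (hcpos k) hδT hs hss' hs' y
  have hIW : ∀ k, ∀ s ∈ Ioo (Aw k) 0, ∀ y, ‖w k s y‖ ≤ M / Real.sqrt (-s) := by
    intro k s hs y
    have h : ‖w k s y‖ ≤ (1 * (M * Real.sqrt ν) / Real.sqrt ν) / Real.sqrt (-s) :=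
      zoom_norm_le (x₀ := x k) hν hα hβ hν (hcpos k) hδT hrate hs y
    have e : (1 : ℝ) * (M * Real.sqrt ν) / Real.sqrt ν = M := by
      rw [one_mul, mul_div_cancel_right₀ _ (Real.sqrt_pos.2 hν).ne']
    rw [e] at h
    exact h
  -- ## (4) extraction of a pointwise limit `W ∈ 𝒦_M` (SAME constant `M`)
  obtain ⟨φ, hφ, W, hW, hpt, -, -, -⟩ := exists_tendsto_of_typeI_seq_Ioo M hAlim hcW hdivW hmildW hIW
  have hφt : Tendsto φ atTop atTop := hφ.tendsto_atTop
  -- ## (5) normalisation at `(−1, 0)`: `‖w_k(−1, 0)‖ = c_k |u(t_k, x_k)| > c_L` for EVERY `k`, and it passes to the limit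
  have hnorm : ∀ k, lerayLevel ≤ ‖w k (-1) 0‖ := by
    intro k
    have et : T + c k ^ 2 * ν * (-1) = t k := by rw [hc2 k]; ring
    have e1 : w k (-1) 0 = (c k * 1) • u (T + c k ^ 2 * ν * (-1)) (x k + (c k * ν) • (0 : E3)) := by
      simp only [hw, smul_stPull_apply]
    rw [e1, smul_zero, add_zero, et, mul_one, norm_smul, Real.norm_eq_abs, abs_of_pos (hcpos k)]
    have hsq : Real.sqrt (T - t k) = c k * Real.sqrt ν := by
      rw [← hc2 k, Real.sqrt_mul (sq_nonneg _), Real.sqrt_sq (hcpos k).le]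
    have h2 : lerayLevel * Real.sqrt ν < c k * ‖u (t k) (x k)‖ * Real.sqrt ν := by
      have h := hfast k
      rw [hsq] at h
      linarith [h, (by ring : c k * Real.sqrt ν * ‖u (t k) (x k)‖ = c k * ‖u (t k) (x k)‖ * Real.sqrt ν)]
    exact (lt_of_mul_lt_mul_right h2 (Real.sqrt_nonneg ν)).le
  have hge : lerayLevel ≤ ‖W (-1) 0‖ :=
    ge_of_tendsto ((hpt (-1) (by norm_num) 0).norm) (Eventually.of_forall fun j => hnorm (φ j))
  -- ## (6) package along the subsequence
  have hwu : ∀ (j : ℕ) (s : ℝ) (y : E3),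
      w (φ j) s y = (c (φ j) * 1) • u (T + c (φ j) ^ 2 * ν * s) (x (φ j) + (c (φ j) * ν) • y) :=
    fun j s y => by simp only [hw, smul_stPull_apply]
  exact ⟨fun j => c (φ j), fun j => x (φ j), W, fun j => hcpos _, hclim.comp hφt, hW,
    fun s hs y => (hpt s hs y).congr fun j => hwu j s y, hge⟩

end Summit.NavierStokesRegularity.NavierStokesRegularity.Theorems.ScenarioCensus.OneLevelTop

end
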